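/-
Copyright (c) 2026 the pub-hodgecm-mathlib formalisation cell (harness21).  Prover seat hodgecm-mathlib-K2E3-p12 (g5), Track B «K2-LIT» ∕ h413
(`stmt-HodgeConjecture-24833`), line `K2_E3_EllipticInputs`, unit U12-d, §L (G⁺-split, local-leaf form): (LBU-2⁺) FROM THE `χ̃`-TWISTED (LBGL-2b) FOR QUADRATIC
QUASI-CHARACTERS.  2026-09-04.
-/
import Summits.HodgeConjecture.HodgeConjecture.Theorems.K2E3GL2NmNilpotentFourierRegularOfTwisted   -- ★ p857526 (this seat): the `hB` dock, `gl2Nm_nilpotentFourierRegular_of_twisted`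
import Literature.NumberTheory.Automorphic.TateGaussSums                                           -- ★ `TateDirect.extend_apply_coe` (`χ̃ = χ` on units)
import HarnessLib

/-!
# K2_E3 road (h413), §L — (G⁺-split), local-leaf form: (LBU-2⁺) ⟸ «(LBGL-2b-Tw)» the `χ̃`-twisted regular nilpotent Fourier regularity

Cell `pub/hodgecm-mathlib` (D-0151), Track B, seat K2E3-p12 (g5), §L line lead (road «U-iso-T»).  `--supports stmt-HodgeConjecture-24833 --as helper`; THEOREMS ONLY
(no definition ∕ instance ∕ notation ∕ named fact ∕ `sorry`); never imports `Cruxes/…/Lines`.  Count-neutral plumbing, companion of ★ p857526.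

* §5 **`exists_quasiChar_of_index_two`** — the sign character `χ_D` of an open index-two subgroup `D ≤ Fˣ` as a `QuasiChar F` (quadratic, non-trivial, `+1` on `D`,
  `−1` off `D`), so that `θ := χ̃_D = Function.extend Units.val (χ_D ·) 0` is a sign adapted to `D` in the sense of ★ p857526 (K2E5-p17 (g3) ∕ K2E5-p10 (g4)
  currency, ★ `TateDirect.extend_*`).
* §6 `isContinuousNontrivial_comp_toPlace` (`ψ ∘ ι` is continuous non-trivial on `L⁺_v`) and **`gl2Nm_nilpotentFourierRegular_of_twisted_local`** — the (LBU-2⁺)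
  letter of ★ p857300 ∕ ★ p857380 (token for token) from the LOCAL LEAF `hTwF` «(LBGL-2b-Tw)»: for every non-archimedean local `F` of characteristic `0`,
  continuous non-trivial `ψ`, quadratic non-trivial `χ : QuasiChar F` and all Haar data, the `χ̃(t·det k)`-twisted regular nilpotent orbital integral composed
  with `𝓕_ψ` is a regular function (binders in the order of (LBGL-2b) ★ p857214 with `(χ) (hχ2) (hχ1)` after `hψ`).  ⇒ (L-B_U)′ :373 at `N = 2` (every `H`)
  ⟸ `hTwF` — ONE analytic statement over local fields, K2E5-p10 (g4)'s (K5) by name.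

HONEST LABEL: HC_CM is proved only modulo the 7 printed citations (2 remaining named inputs: hLiu418 = stmt-HodgeConjecture-24832, h413 = stmt-HodgeConjecture-24833)
until rung 0 closes; count-neutral plumbing; `hTwF` is NOT ★.

References: [HarishChandra1999AdmissibleDistributions] Harish-Chandra (DeBacker–Sally) (1999), §4 p. 11, Thm. 4.4 p. 11, Lemma 5.2, Lemma 7.8;
[LabesseLanglands1979] Labesse–Langlands, Canad. J. Math. 31 (1979), §5; [BernsteinZelevinsky1976] §1.18; [Serre1979] Serre, *Local Fields*, XIV §3.
-/

set_option autoImplicit false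
set_option linter.dupNamespace false   -- `Summit.HodgeConjecture.HodgeConjecture.…` (D-0017 nested layout; lakefile exemption for Summits)

noncomputable section

open MeasureTheory Measure Filter Topology TopologicalSpace NumberField IsDedekindDomain
open scoped MatrixGroups NNReal ENNReal
open Literature.NumberTheory.Rogawski1990 Literature.NumberTheory.Automorphic Literature.NumberTheory.Automorphic.UnitaryGroup Literature.NumberTheory.Automorphic.LocalFieldHaar
open Literature.NumberTheory.GaloisRepresentations Literature.NumberTheory.GaloisRepresentations.IsNonarchimedeanLocalField
open Summit.HodgeConjecture.HodgeConjecture.Cruxes.H413.K2E3LieUnitary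
open Summit.HodgeConjecture.HodgeConjecture.Cruxes.H413.K2E3GL2NmNilpotentFourierRegularOfTwisted (gl2Nm_nilpotentFourierRegular_of_twisted)

namespace Summit.HodgeConjecture.HodgeConjecture.Cruxes.H413.K2E3GL2NmNilpotentFourierRegularOfTwistedLocal

/-! ## §5  The sign character of an open index-two subgroup as a `QuasiChar` -/

section SignChar

variable {F : Type*} [Field F] [TopologicalSpace F] [IsTopologicalRing F] (D : Subgroup Fˣ)

/-- **The sign character `χ_D` of an open index-two subgroup `D ≤ Fˣ` as a quasi-character** (`χ_D = 1` on `D`, `−1` off `D`; continuous because `D` is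
clopen): a quadratic (`χ² = 1`), non-trivial `QuasiChar F` whose extension by zero `χ̃_D` is a sign adapted to `D` in the sense of §§1–4.  At `D = Nm(Eˣ)` this is
the quadratic character `η_{E∕F}` of local class field theory. [cite: BernsteinZelevinsky1976, §1.18] [cite: Serre1979, XIV §3] -/
theorem exists_quasiChar_of_index_two (hDo : IsOpen (D : Set Fˣ)) (hidx : D.index = 2) :
    ∃ χ : QuasiChar F, (∀ u : Fˣ, χ u * χ u = 1) ∧ (∃ u : Fˣ, χ u ≠ 1) ∧
      (∀ u : Fˣ, u ∈ D → ((χ u : ℂˣ) : ℂ) = 1) ∧ (∀ u : Fˣ, u ∉ D → ((χ u : ℂˣ) : ℂ) = -1) := by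
  classical
  -- the underlying homomorphism
  let φ : Fˣ →* ℂˣ :=
    { toFun := fun u => if u ∈ D then 1 else -1
      map_one' := by simp only [D.one_mem, if_true]
      map_mul' := fun u v => by
        have h := Subgroup.mul_mem_iff_of_index_two hidx (a := u) (b := v)
        by_cases hu : u ∈ D <;> by_cases hv : v ∈ D
        · rw [if_pos (h.2 (iff_of_true hu hv)), if_pos hu, if_pos hv, one_mul]
        · rw [if_neg (fun huv => hv ((h.1 huv).1 hu)), if_pos hu, if_neg hv, one_mul]
        · rw [if_neg (fun huv => hu ((h.1 huv).2 hv)), if_neg hu, if_pos hv, mul_one]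
        · rw [if_pos (h.2 (iff_of_false hu hv)), if_neg hu, if_neg hv]; norm_num }
  have hφ : ∀ u, φ u = if u ∈ D then 1 else -1 := fun u => rfl
  -- continuity: `φ` is locally constant (`D` and its complement are open)
  have hDc : IsClosed (D : Set Fˣ) := Subgroup.isClosed_of_isOpen D hDo
  have hcont : Continuous φ := by
    refine (IsLocallyConstant.iff_exists_open φ).2 (fun u => ?_) |>.continuous
    by_cases hu : u ∈ D
    · exact ⟨(D : Set Fˣ), hDo, hu, fun u' hu' => by rw [hφ, hφ, if_pos hu, if_pos (show u' ∈ D from hu')]⟩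
    · exact ⟨(D : Set Fˣ)ᶜ, hDc.isOpen_compl, hu, fun u' hu' => by rw [hφ, hφ, if_neg hu, if_neg (show u' ∉ D from hu')]⟩
  -- a witness off `D` (index two)
  have hne : ∃ u : Fˣ, u ∉ D := by
    by_contra h
    have : D = ⊤ := (Subgroup.eq_top_iff' D).2 fun u => not_not.1 (not_exists.1 h u)
    rw [this, Subgroup.index_top] at hidx
    exact absurd hidx (by norm_num)
  obtain ⟨u₀, hu₀⟩ := hne
  refine ⟨⟨φ, hcont⟩, fun u => ?_, ⟨u₀, ?_⟩, fun u hu => ?_, fun u hu => ?_⟩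
  · show φ u * φ u = 1
    rw [hφ]
    by_cases hu : u ∈ D
    · rw [if_pos hu, one_mul]
    · rw [if_neg hu]; norm_num
  · show φ u₀ ≠ 1
    rw [hφ, if_neg hu₀]
    intro h
    have h' := congrArg (fun z : ℂˣ => (z : ℂ)) h
    norm_num at h'
  · show ((φ u : ℂˣ) : ℂ) = 1
    rw [hφ, if_pos hu, Units.val_one]
  · show ((φ u : ℂˣ) : ℂ) = -1
    rw [hφ, if_neg hu, Units.val_neg, Units.val_one]

end SignChar

/-! ## §6  The CM corollary in LOCAL-LEAF FORM: (LBU-2⁺) ⟸ the `χ̃`-twisted (LBGL-2b) for quadratic quasi-characters -/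

section CMLocal

variable (L : Type) [Field L] [NumberField L] [IsCMField L] (v : HeightOneSpectrum (𝓞 ↥(maximalRealSubfield L)))
  (w : UnitaryGroup.PlacesOver L v) (hw : IsCMField.complexConj L • w.1 = w.1)

/-- `ψ ∘ ι` (restriction of a continuous character of `L_w` non-trivial on the `σ_w`-fixed field `ι(L⁺_v)`) is a continuous non-trivial character of `L⁺_v`.
[cite: HarishChandra1999AdmissibleDistributions, §4 p. 11] -/
theorem isContinuousNontrivial_comp_toPlace (ψ : AddChar (w.1.adicCompletion L) Circle) (hψ : ψ.IsContinuousNontrivial)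
    (hψι : ∃ a : w.1.adicCompletion L, galAdicCompletionMap (L := L) (IsCMField.complexConj L) hw a = a ∧ ψ a ≠ 1) :
    (ψ.compAddMonoidHom (toPlace v w).toAddMonoidHom).IsContinuousNontrivial := by
  have hc1 := IsCMField.complexConj_ne_one L
  refine ⟨hψ.1.comp (continuous_toPlace v w), fun h0 => ?_⟩
  obtain ⟨a', ha', hψa⟩ := hψι
  obtain ⟨r, rfl⟩ := (galAdicCompletionMap_eq_self_iff_mem_range (IsCMField.complexConj L) hc1 v w hw a').1 ha'
  have : ψ.compAddMonoidHom (toPlace v w).toAddMonoidHom r = 1 := by rw [h0]; rfl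
  exact hψa this

/-- **(LBU-2⁺) «(L-B_GL)^{Nm} ON `𝔤𝔩₂(L⁺_v)`» ⟸ THE LOCAL LEAF «(LBGL-2b-Tw)»**: `hTwF` = for every non-archimedean local field `F` of characteristic `0`,
continuous non-trivial `ψ`, QUADRATIC NON-TRIVIAL quasi-character `χ` of `Fˣ` (`χ̃ := Function.extend Units.val (χ ·) 0`), additive Haar `μ𝔤`, Haar `κ` on
`GL₂(𝒪)`, additive Haar `dx`: the `χ̃(t·det k)`-TWISTED regular nilpotent orbital integral composed with `𝓕_ψ` is represented by a locally integrable `Fr`,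
locally constant on `{disc ∈ Fˣ}`, `|disc|^{1∕2}·‖Fr‖` locally bounded (binders in the order of (LBGL-2b) ★ p857214 with `(χ) (hχ2) (hχ1)` after `hψ`).  §4 ∘ §5
(`θ := χ̃_D`, ★ `TateDirect.extend_apply_coe`).  With ★ p857300: (L-B_U)′ :373 at `N = 2`, every `H`, ⟸ `hTwF`.
[cite: HarishChandra1999AdmissibleDistributions, Thm. 4.4 p. 11, Lemma 5.2, Lemma 7.8] [cite: LabesseLanglands1979, §5] -/
theorem gl2Nm_nilpotentFourierRegular_of_twisted_local (ψ : AddChar (w.1.adicCompletion L) Circle) (hψ : ψ.IsContinuousNontrivial)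
    (hψι : ∃ a : w.1.adicCompletion L, galAdicCompletionMap (L := L) (IsCMField.complexConj L) hw a = a ∧ ψ a ≠ 1)
    (hTwF : ∀ (F : Type) [Field F] [ValuativeRel F] [TopologicalSpace F] [IsNonarchimedeanLocalField F] [CharZero F]
      (ψ : AddChar F Circle), ψ.IsContinuousNontrivial → ∀ (χ : QuasiChar F), (∀ u : Fˣ, χ u * χ u = 1) → (∃ u : Fˣ, χ u ≠ 1) →
      ∀ [MeasurableSpace (Matrix (Fin 2) (Fin 2) F)] [BorelSpace (Matrix (Fin 2) (Fin 2) F)] (μ𝔤 : Measure (Matrix (Fin 2) (Fin 2) F)) [μ𝔤.IsAddHaarMeasure]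
        [MeasurableSpace F] [BorelSpace F] [MeasurableSpace (GL (Fin 2) F)] [BorelSpace (GL (Fin 2) F)]
        (κ : Measure ↥(glInt 2 F)) [IsHaarMeasure κ] (dx : Measure F) [dx.IsAddHaarMeasure],
      ∃ Fr : Matrix (Fin 2) (Fin 2) F → ℂ, LocallyIntegrable Fr μ𝔤 ∧
        (∀ f : Matrix (Fin 2) (Fin 2) F → ℂ, IsLocSmooth f →
          ∫ p : ↥(glInt 2 F) × F, Function.extend ((↑) : Fˣ → F) (fun u => ((χ u : ℂˣ) : ℂ)) 0 (p.2 * (((p.1 : GL (Fin 2) F) : Matrix (Fin 2) (Fin 2) F)).det) *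
            (fun Y : Matrix (Fin 2) (Fin 2) F => ∫ X, ((ψ (Matrix.trace (Y * X)) : Circle) : ℂ) * f X ∂μ𝔤)
              (((p.1 : GL (Fin 2) F) : Matrix (Fin 2) (Fin 2) F) * !![0, p.2; 0, 0] * ((((p.1 : GL (Fin 2) F))⁻¹ : GL (Fin 2) F) : Matrix (Fin 2) (Fin 2) F)) ∂(κ.prod dx) =
            ∫ X, f X * Fr X ∂μ𝔤) ∧
        (∀ X : Matrix (Fin 2) (Fin 2) F, IsUnit X.charpoly.discr → ∀ᶠ Y in 𝓝 X, Fr Y = Fr X) ∧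
        (∀ C : Set (Matrix (Fin 2) (Fin 2) F), IsCompact C → ∃ B : ℝ, ∀ X ∈ C,
            ((NNReal.sqrt (normAbs F X.charpoly.discr) : ℝ≥0) : ℝ) * ‖Fr X‖ ≤ B)) :
    ∀ [MeasurableSpace (Matrix (Fin 2) (Fin 2) (v.adicCompletion ↥(maximalRealSubfield L)))] [BorelSpace (Matrix (Fin 2) (Fin 2) (v.adicCompletion ↥(maximalRealSubfield L)))] (μ' : Measure (Matrix (Fin 2) (Fin 2) (v.adicCompletion ↥(maximalRealSubfield L)))) [μ'.IsAddHaarMeasure]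
      (T' : ((Matrix (Fin 2) (Fin 2) (v.adicCompletion ↥(maximalRealSubfield L))) → ℂ) → ℂ),
      (∀ f₁ f₂ : (Matrix (Fin 2) (Fin 2) (v.adicCompletion ↥(maximalRealSubfield L))) → ℂ, IsLocSmooth f₁ → IsLocSmooth f₂ → T' (f₁ + f₂) = T' f₁ + T' f₂) →
      (∀ (a : ℂ) (f : (Matrix (Fin 2) (Fin 2) (v.adicCompletion ↥(maximalRealSubfield L))) → ℂ), IsLocSmooth f → T' (a • f) = a * T' f) →
      (∀ g : GL (Fin 2) (v.adicCompletion ↥(maximalRealSubfield L)), (∃ e : w.1.adicCompletion L, toPlace v w ((g : Matrix (Fin 2) (Fin 2) (v.adicCompletion ↥(maximalRealSubfield L))).det) * (e * galAdicCompletionMap (L := L) (IsCMField.complexConj L) hw e) = 1) →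
        ∀ f : (Matrix (Fin 2) (Fin 2) (v.adicCompletion ↥(maximalRealSubfield L))) → ℂ, IsLocSmooth f → T' (fun X => f ((g : Matrix (Fin 2) (Fin 2) (v.adicCompletion ↥(maximalRealSubfield L))) * X * ((g⁻¹ : GL (Fin 2) (v.adicCompletion ↥(maximalRealSubfield L))) : Matrix (Fin 2) (Fin 2) (v.adicCompletion ↥(maximalRealSubfield L))))) = T' f) →
      (∀ f : (Matrix (Fin 2) (Fin 2) (v.adicCompletion ↥(maximalRealSubfield L))) → ℂ, IsLocSmooth f → (∀ X ∈ tsupport f, ¬ IsNilpotent X) → T' f = 0) →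
      ∃ Fn' : (Matrix (Fin 2) (Fin 2) (v.adicCompletion ↥(maximalRealSubfield L))) → ℂ, LocallyIntegrable Fn' μ' ∧
        (∀ f : (Matrix (Fin 2) (Fin 2) (v.adicCompletion ↥(maximalRealSubfield L))) → ℂ, IsLocSmooth f →
          T' (fun Y => ∫ X, ((ψ (toPlace v w (Matrix.trace (Y * X))) : Circle) : ℂ) * f X ∂μ') = ∫ X, f X * Fn' X ∂μ') ∧
        (∀ X : Matrix (Fin 2) (Fin 2) (v.adicCompletion ↥(maximalRealSubfield L)), IsUnit X.charpoly.discr → ∀ᶠ Y in 𝓝 X, Fn' Y = Fn' X) ∧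
        (∀ C : Set (Matrix (Fin 2) (Fin 2) (v.adicCompletion ↥(maximalRealSubfield L))), IsCompact C → ∃ B : ℝ, ∀ X ∈ C, ((NNReal.sqrt (normAbs (v.adicCompletion ↥(maximalRealSubfield L)) X.charpoly.discr) : ℝ≥0) : ℝ) * ‖Fn' X‖ ≤ B) := by
  intro _ _ μ'' _ T' hT1 hT2 hT3 hT4
  haveI : CharZero (v.adicCompletion ↥(maximalRealSubfield L)) :=
    charZero_of_injective_algebraMap (algebraMap ↥(maximalRealSubfield L) (v.adicCompletion ↥(maximalRealSubfield L))).injective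
  refine gl2Nm_nilpotentFourierRegular_of_twisted L v w hw ψ hψ hψι ?_ μ'' T' hT1 hT2 hT3 hT4
  intro D hDo hD2 hidx _ _ _ _ κ _ dx _ _ _ μ' _
  obtain ⟨χ, hχ2, hχ1, hχD, hχD'⟩ := exists_quasiChar_of_index_two D hDo hidx
  have hψF := isContinuousNontrivial_comp_toPlace L v w hw ψ hψ hψι
  have hψF_apply : ∀ t, ψ.compAddMonoidHom (toPlace v w).toAddMonoidHom t = ψ (toPlace v w t) := fun t => rfl
  obtain ⟨Fr, hint, hrep, hlc, hbd⟩ := hTwF (v.adicCompletion ↥(maximalRealSubfield L)) (ψ.compAddMonoidHom (toPlace v w).toAddMonoidHom) hψF χ hχ2 hχ1 μ' κ dx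
  refine ⟨Function.extend ((↑) : (v.adicCompletion ↥(maximalRealSubfield L))ˣ → v.adicCompletion ↥(maximalRealSubfield L)) (fun u => ((χ u : ℂˣ) : ℂ)) 0,
    fun u hu => by rw [TateDirect.extend_apply_coe]; exact hχD u hu,
    fun u hu => by rw [TateDirect.extend_apply_coe]; exact hχD' u hu, Fr, hint, fun f hf => ?_, hlc, hbd⟩
  have key := hrep f hf
  simp only [hψF_apply] at key
  exact key

end CMLocal

end Summit.HodgeConjecture.HodgeConjecture.Cruxes.H413.K2E3GL2NmNilpotentFourierRegularOfTwistedLocal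

end
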